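import Summits.CriticalPhenomena.PercolationContinuityZ3.Theorems.Transplant.SkelPhiInputs
import Summits.CriticalPhenomena.PercolationContinuityZ3.Theorems.Transplant.SkelPhiFatSeqOff
import Summits.CriticalPhenomena.PercolationContinuityZ3.Theorems.Transplant.KNLevelsEquivariance
import HarnessLib

/-!
# D″ node, STRUCTURE-FREE layer L5′.3e (V98 p3 column; DPRIME-SCOPE p3 addendum L.3/L.4, refuter's checklist DP8): the Step-I′ inputs are
# FRAME-EQUIVARIANT — a frame `α` (`α t = c`, `φ ∘ α = φ + (φ c − φ t)`) carries the shifted fat prisms, the fat rectangles and their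
# side-halves at `t` onto those at `c` (finset forms), hence the uniqueness zone and every link input have the SAME probability at `c` as at
# `t`; so the inputs certified at the base vertices (`exists_stepI`) hold at EVERY vertex — at the kit centre `c = rectCtr …` of the two-scale
# Step-IV kit in particular — φ-level re-cut of `SkelScales` §3 (`image_frame_fatSeq`, `real_inputs_frame`, `exists_inputs_at_center`)

builds on p205010 (kernel theorem, internal audit signed; external expert review pending) — nothing in this file uses p205010.
Lane `prim-bschramm`, seat `prim-bschramm-p3` (gen 7; D″ design owner); helper file (`--supports stmt-CriticalPhenomena-4575`).
* §1 `image_frame_cylBallFin`, **`image_frame_fatSeqOff`** (every level, every shift: the radii are centre-free), `image_frame_fatSeq`,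
  `image_frame_rectPrismFin`, **`image_frame_rhalf`**, `image_frame_rside`;
* §2 **`real_zone_frame`**, **`real_link_frame`** (equal probabilities at `c` and `t`), **`real_event_frame`** (every `StepI.event` over data with
  `Λ := fatSeqOff off`: the event at `(c, s, og)` has the probability of the event at `(t, s, og)`);
* §3 **`exists_inputs_at_center`**: if every input over `StepI.index types Sz Sx Sy` holds at the running density `q` with probability `> 1 − δ`, then
  for EVERY vertex `c` (framed to its type `t_c`) the zone of `fatSeqOff off c` at every `M ∈ Sz` and the four halves of the band rectangles AT `c`
  of every extent in `Sx`/`Sy` hold with probability `> 1 − δ` (the `h1`/`h2` inputs of `KNLevels.stepIV_out` at a kit centre).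
[cite: KozmaNitzan2024, §4 p. 20 ((22)–(23): the lattice symmetries place the local objects), pp. 19–21 ((21)–(25))]
-/

noncomputable section

open MeasureTheory

namespace Summit.CriticalPhenomena.PercolationContinuityZ3.Theorems.Transplant

namespace Skelφ

open Literature.Probability.Percolation Literature.Probability.LatticeModels SimpleGraph KNLevels
open Literature.Probability.Percolation.KozmaNitzan.Cells (oth oth_ne oth_oth)
open Literature.Barriers.CriticalPhenomena (graphBall graphBall_finite mem_graphBall_self graphBall_mono mem_graphBall_map)
open scoped Classical

variable {V : Type} [DecidableEq V] {G : SimpleGraph V} [G.LocallyFinite] {φ : V → Site 2} {types : Finset V}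

/-! ## §1 Frame images, finset forms -/

section Frame

variable {α : G ≃g G} {t c : V} (hαt : α t = c) (hφ : ∀ w, φ (α w) = φ w + (φ c - φ t))
include hαt hφ

/-- A frame carries the fat prisms at `t` onto those at `c` (finset form). [folklore] -/
theorem image_frame_cylBallFin (k ρ : ℕ) : (cylBallFin G φ t k ρ).image α = cylBallFin G φ c k ρ := by
  ext v
  rw [Finset.mem_image, mem_cylBallFin, ← image_cylBall_of_frame hαt hφ k ρ]
  constructor
  · rintro ⟨u, hu, rfl⟩; exact ⟨u, (mem_cylBallFin G φ).1 hu, rfl⟩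
  · rintro ⟨u, hu, rfl⟩; exact ⟨u, (mem_cylBallFin G φ).2 hu, rfl⟩

/-- **A frame carries the shifted fat prisms at `t` onto those at `c`** (every level, every shift — the radii are centre-free).
[cite: KozmaNitzan2024, §4 p. 20 ((22)–(23))] -/
theorem image_frame_fatSeqOff [Countable V] (hfr : Frames G φ types) {p : unitInterval} (hC : CylSubcritical G φ types p) (off n : ℕ) :
    (fatSeqOff hfr hC off t n).image α = fatSeqOff hfr hC off c n :=
  image_frame_cylBallFin hαt hφ n _

/-- The whole family: `(fun n => (fatSeqOff off t n).image α) = fatSeqOff off c`. [folklore] -/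
theorem image_frame_fatSeqOff_fun [Countable V] (hfr : Frames G φ types) {p : unitInterval} (hC : CylSubcritical G φ types p) (off : ℕ) :
    (fun n => (fatSeqOff hfr hC off t n).image α) = fatSeqOff hfr hC off c :=
  funext fun n => image_frame_fatSeqOff hαt hφ hfr hC off n

/-- A frame carries the fat rectangles at `t` onto those at `c` (finset form). [folklore] -/
theorem image_frame_rectPrismFin (a : Fin 2 → ℕ) (R : ℕ) : (rectPrismFin G φ t a R).image α = rectPrismFin G φ c a R := by
  ext v
  rw [Finset.mem_image, mem_rectPrismFin, ← image_rectPrism_of_frame hαt hφ a R]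
  constructor
  · rintro ⟨u, hu, rfl⟩; exact ⟨u, (mem_rectPrismFin G φ).1 hu, rfl⟩
  · rintro ⟨u, hu, rfl⟩; exact ⟨u, (mem_rectPrismFin G φ).2 hu, rfl⟩

/-- A frame carries directed sides onto directed sides (finset form). [folklore] -/
theorem image_frame_rside (a : Fin 2 → ℕ) (R : ℕ) (i : Fin 2) (σ : ℤ) : (rside G φ t a R i σ).image α = rside G φ c a R i σ := by
  rw [← Finset.coe_inj, Finset.coe_image]; exact image_rside_of_frame hαt hφ a R i σ

/-- **A frame carries side-halves onto side-halves** (relative skeleton coordinates are preserved). [cite: KozmaNitzan2024, §4 p. 20 ((22)–(23))] -/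
theorem image_frame_rhalf (a : Fin 2 → ℕ) (R : ℕ) (i : Fin 2) (σ τ : ℤ) : (rhalf G φ t a R i σ τ).image α = rhalf G φ c a R i σ τ := by
  have hco : ∀ w j, φ (α w) j - φ c j = φ w j - φ t j := fun w j => by
    have := congrFun (hφ w) j
    simp only [Pi.add_apply, Pi.sub_apply] at this
    linarith
  ext v
  rw [rhalf, rhalf, Finset.mem_filter, ← image_frame_rside hαt hφ a R i σ, Finset.mem_image, Finset.mem_image]
  constructor
  · rintro ⟨u, hu, rfl⟩
    rw [Finset.mem_filter] at hu
    exact ⟨⟨u, hu.1, rfl⟩, by rw [hco]; exact hu.2⟩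
  · rintro ⟨⟨u, hu, rfl⟩, hh⟩
    refine ⟨u, Finset.mem_filter.2 ⟨hu, ?_⟩, rfl⟩
    rw [hco] at hh; exact hh

/-! ## §2 Equal probabilities at `c` and at `t` -/

/-- **The uniqueness zone of the shifted fat prisms at `c` has the probability of the one at `t`.** [cite: KozmaNitzan2024, §4 p. 20 ((23))] -/
theorem real_zone_frame [Countable V] (hfr : Frames G φ types) {p : unitInterval} (hC : CylSubcritical G φ types p) (q : unitInterval)
    (off k M : ℕ) :
    (bondPercolation G q).real (UniqZone.zone G (fatSeqOff hfr hC off c) k M) =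
      (bondPercolation G q).real (UniqZone.zone G (fatSeqOff hfr hC off t) k M) := by
  rw [← image_frame_fatSeqOff_fun hαt hφ hfr hC off]; exact real_zone_image_iso α q _ k M

/-- **A link input at `c` has the probability of the same link input at `t`.** [cite: KozmaNitzan2024, §4 p. 20 ((22)–(23))] -/
theorem real_link_frame [Countable V] (hfr : Frames G φ types) {p : unitInterval} (hC : CylSubcritical G φ types p) (q : unitInterval)
    (off k : ℕ) (a : Fin 2 → ℕ) (R : ℕ) (i : Fin 2) (σ τ : ℤ) :
    (bondPercolation G q).real (linkIn (rectPrism G φ c a R) (fatSeqOff hfr hC off c k) (rhalf G φ c a R i σ τ)) =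
      (bondPercolation G q).real (linkIn (rectPrism G φ t a R) (fatSeqOff hfr hC off t k) (rhalf G φ t a R i σ τ)) := by
  rw [← coe_rectPrismFin, ← coe_rectPrismFin, ← image_frame_rectPrismFin hαt hφ a R, ← image_frame_fatSeqOff hαt hφ hfr hC off k,
    ← image_frame_rhalf hαt hφ a R i σ τ]
  exact real_linkIn_image_iso α q _ _ _

/-- **Every Step-I′ input over the shifted fat prisms is frame-equivariant**: for data `D` with `D.Λ = fatSeqOff off`, the input at `(c, s, og)` has the
probability of the input at `(t, s, og)`. [cite: KozmaNitzan2024, §4 p. 20 ((22)–(23))] -/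
theorem real_event_frame [Countable V] (hfr : Frames G φ types) {p : unitInterval} (hC : CylSubcritical G φ types p) (q : unitInterval)
    {D : StepI.Data V} {off : ℕ} (hD : D.Λ = fatSeqOff hfr hC off) (s : ℕ) (og : Option (Fin 2 × ℤˣ × ℤˣ)) :
    (bondPercolation G q).real (StepI.event G φ D (c, s, og)) = (bondPercolation G q).real (StepI.event G φ D (t, s, og)) := by
  rcases og with _ | ⟨i, σ, τ⟩
  · rw [StepI.event_none, StepI.event_none, hD]; exact real_zone_frame hαt hφ hfr hC q off D.k s
  · rw [StepI.event_some, StepI.event_some, hD]; exact real_link_frame hαt hφ hfr hC q off D.k _ _ i σ τ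

end Frame

/-! ## §3 The inputs at EVERY vertex -/

/-- **The Step-I′ inputs at every vertex** (one frame per centre): if at the running density `q` every input over `StepI.index types Sz Sx Sy` has
probability `> 1 − δ`, then for every vertex `c` there is a base vertex `t` (its type) such that AT `c`: the uniqueness zone of `fatSeqOff off c` between
`D.k` and every `M ∈ Sz`, and the four halves of the band rectangle of every extent `ℓ ∈ Sx` (axis `0`) / `ℓ ∈ Sy` (axis `1`), all have probability
`> 1 − δ` — the `h1`/`h2` inputs of `KNLevels.stepIV_out` at a kit centre. [cite: KozmaNitzan2024, §4 pp. 19–21 ((21)–(25))] -/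
theorem exists_inputs_at_center [Countable V] (hfr : Frames G φ types) {p : unitInterval} (hC : CylSubcritical G φ types p)
    {D : StepI.Data V} {off : ℕ} (hD : D.Λ = fatSeqOff hfr hC off) {Sz Sx Sy : Finset ℕ} {q : unitInterval} {δ : ℝ}
    (h : ∀ i ∈ StepI.index types Sz Sx Sy, 1 - δ < (bondPercolation G q).real (StepI.event G φ D i)) (c : V) :
    ∃ t ∈ types,
      (∀ M ∈ Sz, 1 - δ < (bondPercolation G q).real (StepI.event G φ D (c, M, none))) ∧
      (∀ ℓ ∈ Sx, ∀ σ τ : ℤˣ, 1 - δ < (bondPercolation G q).real (StepI.event G φ D (c, ℓ, some (0, σ, τ)))) ∧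
      (∀ ℓ ∈ Sy, ∀ σ τ : ℤˣ, 1 - δ < (bondPercolation G q).real (StepI.event G φ D (c, ℓ, some (1, σ, τ)))) := by
  obtain ⟨t, ht, α, hαt, hφ⟩ := hfr c
  refine ⟨t, ht, fun M hM => ?_, fun ℓ hℓ σ τ => ?_, fun ℓ hℓ σ τ => ?_⟩
  · rw [real_event_frame hαt hφ hfr hC q hD]; exact h _ (StepI.mem_index_none ht hM)
  · rw [real_event_frame hαt hφ hfr hC q hD]; exact h _ (StepI.mem_index_zero ht hℓ σ τ)
  · rw [real_event_frame hαt hφ hfr hC q hD]; exact h _ (StepI.mem_index_one ht hℓ σ τ)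

end Skelφ

end Summit.CriticalPhenomena.PercolationContinuityZ3.Theorems.Transplant

end
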